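import Summits.NavierStokesRegularity.OSWSelfSimilar.SheetREvenResolvent
import Summits.NavierStokesRegularity.OSWSelfSimilar.SheetRResolventIdentity
import HarnessLib

/-!
# SHEET-ℝ frame, EVEN ZERO-MASS class `E⁺₀` — dictionary layer 6: the RESOLVENT IDENTITY for the even perturbed resolvent,
# `IsPseudoResolvent {Re σ > −m} R⁺_K`, holomorphy

HONEST FRAMING (cell ns-blowup GROUP B / zone Z3, case Z3-SR-SPEC EVEN half; 1-D MODEL certificate frame (viscous gCLM/OSW sheet on the
line); not Euler/NS; «violates: none — MODEL»).  Nothing here asserts that a profile exists; the (S1⁺) datum `GardingDataKE` is the HYPOTHESIS.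
Twin of `SheetRPerturbedResolventIdentityC` §1 on `E⁺₀`:

* `resolventKE_absorb` — `R⁺_K(z)(G + (z − w)R⁺_K(w)G) = R⁺_K(w)G` (weak uniqueness `pairOpKE_unique`);
* `resolventKE_sub` — the first resolvent identity `R⁺_K(z) − R⁺_K(w) = (w − z)R⁺_K(z)R⁺_K(w)`;
* `isPseudoResolventKE` — `IsPseudoResolvent {σ | −m < Re σ} (resolventKE hL K h)` (the structure cert-4's `PseudoResolvent*` files and the
  even-half assembly `SheetRSpectrumEvenPointAssembly` are keyed on), `differentiableOn_resolventKE` (holomorphy), `resolventKE_comm`.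
No definition, no named fact.  WHAT THIS IS NOT: not NS.
-/

noncomputable section

namespace Summit.NavierStokesRegularity.OSWSelfSimilar
namespace SheetREvenResolventIdentity

open _root_.MeasureTheory _root_.Set _root_.Filter _root_.Real SheetRWeakProfilePV SheetRWeakToStrong SheetREnergyClass SheetRWeightedMeasure
  SheetRLinearisedTests SheetREnergySpace SheetRTestSpace SheetRLinearisedFormBounds SheetREvenTests SheetREvenEnergySpace SheetREvenForms
  SheetREvenPairOperator SheetREvenPairUniqueness SheetREvenResolvent SheetRComplexPivot SheetRResolventIdentity
  Literature.Analysis.OperatorTheory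
open scoped Topology ENNReal

variable {L D₀ D₁ V₀ c m : ℝ} {d V : ℝ → ℝ}

/-- **Shift of the potential**: for an even energy-space profile and a parity-free test,
`linForm L d (V + s) u u₁ φ φ₁ = linForm L d V u u₁ φ φ₁ + s·∫ w u φ`. [folklore] -/
theorem linForm_shiftE {hL : 0 < L} {K : EspE L hL →L[ℝ] W L} (h : GardingDataKE L hL d V K D₀ D₁ V₀ c m) (s : ℝ) {φ φ₁ : ℝ → ℝ}
    (hφ : IsCompactTestAny φ φ₁) (p : EspE L hL) :
    Integrable (fun y => (L ^ 2 + y ^ 2) * (profile p y * φ y)) ∧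
      linForm L d (fun ξ => V ξ + s) (profile p) (derE p) φ φ₁ = linForm L d V (profile p) (derE p) φ φ₁
        + s * ∫ y, (L ^ 2 + y ^ 2) * (profile p y * φ y) := by
  obtain ⟨hum, hu₁m, h0, h1, -, -⟩ := profileE_facts hL p
  obtain ⟨hint, -⟩ := abs_linForm_le_any hL h.d_meas h.V_meas h.D₁_nonneg h.d_le h.V_le hφ hum hu₁m h0 h1
  have huφ := integrable_weight_fun_mul_any hL hum h0 hφ
  refine ⟨huφ, ?_⟩
  unfold linForm
  rw [← integral_const_mul, ← integral_add hint (huφ.const_mul s)]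
  refine integral_congr_ae (Eventually.of_forall fun y => ?_)
  ring

/-- **Absorption** for the even perturbed resolvent: `R⁺_K(z)(G + (z − w)R⁺_K(w)G) = R⁺_K(w)G` for `z, w` in the half-plane. [folklore] -/
theorem resolventKE_absorb (hL : 0 < L) (K : EspE L hL →L[ℝ] W L) (h : GardingDataKE L hL d V K D₀ D₁ V₀ c m) {z w : ℂ}
    (hz : -m < z.re) (hw : -m < w.re) (G : Wc L) :
    resolventKE hL K h z (G + (z - w) • resolventKE hL K h w G) = resolventKE hL K h w G := by
  set Φ := resolventKE hL K h w G with hΦ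
  obtain ⟨happw, hre, him, hweakw⟩ := resolventKE_weak hL K h hw G
  set P := pairOpKE hL K h w hw (toPair L G) with hP
  have hsolves : ∀ v v₁ : ℝ → ℝ, IsCompactTestE v v₁ → ∫ y, v y = 0 →
      linForm L d (fun ξ => V ξ + z.re) (profile P.fst) (derE P.fst) v v₁
            + (∫ y, (L ^ 2 + y ^ 2) * (((K P.fst : W L) : ℝ → ℝ) y * v y))
            - z.im * ∫ y, (L ^ 2 + y ^ 2) * (profile P.snd y * v y) =
          ∫ y, (L ^ 2 + y ^ 2) * ((((toPair L (G + (z - w) • Φ)).fst : W L) : ℝ → ℝ) y * v y) ∧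
        linForm L d (fun ξ => V ξ + z.re) (profile P.snd) (derE P.snd) v v₁
            + (∫ y, (L ^ 2 + y ^ 2) * (((K P.snd : W L) : ℝ → ℝ) y * v y))
            + z.im * ∫ y, (L ^ 2 + y ^ 2) * (profile P.fst y * v y) =
          ∫ y, (L ^ 2 + y ^ 2) * ((((toPair L (G + (z - w) • Φ)).snd : W L) : ℝ → ℝ) y * v y) := by
    intro v v₁ hv h0
    obtain ⟨e1, e2⟩ := hweakw v v₁ hv h0
    have hva := hv.toIsCompactTestAny
    obtain ⟨hiR, hzR⟩ := linForm_shiftE h z.re hva P.fst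
    obtain ⟨-, hwR⟩ := linForm_shiftE h w.re hva P.fst
    obtain ⟨hiI, hzI⟩ := linForm_shiftE h z.re hva P.snd
    obtain ⟨-, hwI⟩ := linForm_shiftE h w.re hva P.snd
    obtain ⟨hdre, hdim⟩ := reW_imW_add_smul_ae hL G Φ (z - w)
    obtain ⟨htf, hts⟩ := toPair_fst_snd (G + (z - w) • Φ)
    obtain ⟨hiG1, -⟩ := integrable_weight_mul_any hL (reW L G) hva
    obtain ⟨hiG2, -⟩ := integrable_weight_mul_any hL (imW L G) hva
    have hdat1 : ∫ y, (L ^ 2 + y ^ 2) * ((((toPair L (G + (z - w) • Φ)).fst : W L) : ℝ → ℝ) y * v y) =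
        (∫ y, (L ^ 2 + y ^ 2) * (((reW L G : W L) : ℝ → ℝ) y * v y))
          + (z - w).re * (∫ y, (L ^ 2 + y ^ 2) * (profile P.fst y * v y))
          - (z - w).im * ∫ y, (L ^ 2 + y ^ 2) * (profile P.snd y * v y) := by
      have e : ∫ y, (L ^ 2 + y ^ 2) * ((((toPair L (G + (z - w) • Φ)).fst : W L) : ℝ → ℝ) y * v y) =
          ∫ y, ((L ^ 2 + y ^ 2) * (((reW L G : W L) : ℝ → ℝ) y * v y)
            + (z - w).re * ((L ^ 2 + y ^ 2) * (profile P.fst y * v y))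
            - (z - w).im * ((L ^ 2 + y ^ 2) * (profile P.snd y * v y))) := by
        rw [htf]
        refine integral_congr_ae ?_
        filter_upwards [hdre, hre, him] with y hy hyr hyi
        rw [hy, hyr, hyi]; ring
      have hI12 : Integrable (fun y => (L ^ 2 + y ^ 2) * (((reW L G : W L) : ℝ → ℝ) y * v y)
          + (z - w).re * ((L ^ 2 + y ^ 2) * (profile P.fst y * v y))) := hiG1.add (hiR.const_mul _)
      rw [e, integral_sub hI12 (hiI.const_mul _), integral_add hiG1 (hiR.const_mul _), integral_const_mul, integral_const_mul]
    have hdat2 : ∫ y, (L ^ 2 + y ^ 2) * ((((toPair L (G + (z - w) • Φ)).snd : W L) : ℝ → ℝ) y * v y) =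
        (∫ y, (L ^ 2 + y ^ 2) * (((imW L G : W L) : ℝ → ℝ) y * v y))
          + (z - w).re * (∫ y, (L ^ 2 + y ^ 2) * (profile P.snd y * v y))
          + (z - w).im * ∫ y, (L ^ 2 + y ^ 2) * (profile P.fst y * v y) := by
      have e : ∫ y, (L ^ 2 + y ^ 2) * ((((toPair L (G + (z - w) • Φ)).snd : W L) : ℝ → ℝ) y * v y) =
          ∫ y, ((L ^ 2 + y ^ 2) * (((imW L G : W L) : ℝ → ℝ) y * v y)
            + (z - w).re * ((L ^ 2 + y ^ 2) * (profile P.snd y * v y))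
            + (z - w).im * ((L ^ 2 + y ^ 2) * (profile P.fst y * v y))) := by
        rw [hts]
        refine integral_congr_ae ?_
        filter_upwards [hdim, hre, him] with y hy hyr hyi
        rw [hy, hyr, hyi]; ring
      have hI12 : Integrable (fun y => (L ^ 2 + y ^ 2) * (((imW L G : W L) : ℝ → ℝ) y * v y)
          + (z - w).re * ((L ^ 2 + y ^ 2) * (profile P.snd y * v y))) := hiG2.add (hiI.const_mul _)
      rw [e, integral_add hI12 (hiR.const_mul _), integral_add hiG2 (hiI.const_mul _), integral_const_mul, integral_const_mul]
    rw [hdat1, hdat2, hzR, hzI, Complex.sub_re, Complex.sub_im]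
    rw [hwR] at e1
    rw [hwI] at e2
    constructor
    · linarith
    · linarith
  have huniq := pairOpKE_unique hL K h z hz (toPair L (G + (z - w) • Φ)) hsolves
  obtain ⟨happz, -, -, -⟩ := resolventKE_weak hL K h hz (G + (z - w) • Φ)
  rw [happz, ← huniq, ← happw]

/-- **First resolvent identity** for the even perturbed resolvent. [folklore] -/
theorem resolventKE_sub (hL : 0 < L) (K : EspE L hL →L[ℝ] W L) (h : GardingDataKE L hL d V K D₀ D₁ V₀ c m) {z w : ℂ}
    (hz : -m < z.re) (hw : -m < w.re) (G : Wc L) :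
    resolventKE hL K h z G - resolventKE hL K h w G = (w - z) • resolventKE hL K h z (resolventKE hL K h w G) := by
  have hab := resolventKE_absorb hL K h hz hw G
  rw [map_add, map_smul] at hab
  have h1 : resolventKE hL K h z G = resolventKE hL K h w G - (z - w) • resolventKE hL K h z (resolventKE hL K h w G) :=
    eq_sub_of_add_eq hab
  rw [h1, ← neg_sub z w, neg_smul]
  abel

/-- **`σ ↦ R⁺_K(σ)` is a pseudo-resolvent on `{Re σ > −m}`** (Kato VIII-§1.1 (1.2)). [folklore] -/
theorem isPseudoResolventKE (hL : 0 < L) (K : EspE L hL →L[ℝ] W L) (h : GardingDataKE L hL d V K D₀ D₁ V₀ c m) :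
    IsPseudoResolvent {σ : ℂ | -m < σ.re} (resolventKE hL K h) := by
  intro z hz w hw
  refine ContinuousLinearMap.ext fun G => ?_
  show resolventKE hL K h z G - resolventKE hL K h w G = (w - z) • resolventKE hL K h z (resolventKE hL K h w G)
  exact resolventKE_sub hL K h hz hw G

/-- **Holomorphy** of `σ ↦ R⁺_K(σ)` on the half-plane `{Re σ > −m}`. [folklore] -/
theorem differentiableOn_resolventKE (hL : 0 < L) (K : EspE L hL →L[ℝ] W L) (h : GardingDataKE L hL d V K D₀ D₁ V₀ c m) :
    DifferentiableOn ℂ (resolventKE hL K h) {σ : ℂ | -m < σ.re} :=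
  (isPseudoResolventKE hL K h).differentiableOn (isOpen_halfPlane m)

/-- The values of the even perturbed resolvent commute. [folklore] -/
theorem resolventKE_comm (hL : 0 < L) (K : EspE L hL →L[ℝ] W L) (h : GardingDataKE L hL d V K D₀ D₁ V₀ c m) {z w : ℂ}
    (hz : -m < z.re) (hw : -m < w.re) : resolventKE hL K h z * resolventKE hL K h w = resolventKE hL K h w * resolventKE hL K h z :=
  (isPseudoResolventKE hL K h).comm hz hw

/-- **Operator-norm form of the sharp bound**: `‖R⁺_K(σ)‖ ≤ 1/(m + Re σ)`. [folklore] -/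
theorem opNorm_resolventKE_le (hL : 0 < L) (K : EspE L hL →L[ℝ] W L) (h : GardingDataKE L hL d V K D₀ D₁ V₀ c m) {σ : ℂ}
    (hσ : -m < σ.re) : ‖resolventKE hL K h σ‖ ≤ 1 / (m + σ.re) := by
  have hc : 0 < m + σ.re := by linarith
  refine ContinuousLinearMap.opNorm_le_bound _ (by positivity) fun G => ?_
  rw [one_div, inv_mul_eq_div]
  exact norm_resolventKE_le_inv hL K h hσ G

end SheetREvenResolventIdentity
end Summit.NavierStokesRegularity.OSWSelfSimilar

end
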